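import Summits.Ventures.YMGap.RobustBall.UniformMassGapKR
import Summits.Ventures.YMGap.RobustBall.MassGapOnBallMassive
import Summits.Ventures.YMGap.RobustBall.LatticeSumL1
import Summits.Ventures.YMGap.RobustBall.PeriodisedBox
import Summits.Ventures.YMGap.Thresholds.PlaquetteSusceptibility
import Summits.Ventures.YMGap.Thresholds.MassGapAtMassive
import Summits.Ventures.YMGap.RobustBall.ThermodynamicVariance
import HarnessLib

/-!
# Venture YMGap, track ROBUST-BALL — EXPONENTIAL AND POLYNOMIAL MOMENTS OF THE TRUNCATED CORRELATIONS: the exponentially weighted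
# susceptibility `Σ_v e^{a‖v‖} |cov(F₁, F₂∘θ_v)|` is finite for every `a` below the clustering rate, hence every moment
# `Σ_v ‖v‖^k |cov(F₁, F₂∘θ_v)|` (second-moment correlation length numerators included) is finite

HONEST FRAMING. WHAT THIS IS: a venture file (cell `pub-ymgap`, track Y2 ROBUST-BALL, seat ds-3, theorems only): lattice-sum bookkeeping on
the cell's massive rows. An `ℓ^∞`-exponential decay rate `m` of `x ↦ cov_μ(F₁, F₂∘θ_x)` (the clause of `IsMassiveState`, or C-UNIF's
explicit rate) gives, for every `0 ≤ a < m`: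

* `sum_exp_mul_abs_le_of_decay` / `summable_exp_mul_abs_of_decay` — `Σ_v e^{a‖v‖_∞}|G v| ≤ max(C,0)((1+r)/(1−r))^d`, `r = e^{−(m−a)/d}`
  (the EXPONENTIALLY WEIGHTED susceptibility is finite: «exponential correlation length ≤ 1/a for every a < m», the defining property of a
  mass gap `≥ m` in the susceptibility sense);
* `summable_pow_mul_abs_of_decay` — every polynomial moment `Σ_v ‖v‖_∞^k |G v|` is finite (`x^k ≤ k! a^{−k} e^{ax}`), in particular the
  numerator `Σ_v ‖v‖² |cov(F, F∘θ_v)|` of the second-moment correlation length `ξ₂`;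
* MASSIVE STATES (`exp_moments_of_isMassiveState`, `d = 4`): for every massive state and all bounded measurable gauge-invariant local
  `F₁, F₂`, all exponential moments below its rate and all polynomial moments of the truncated correlation are finite;
* EXPLICIT CELL (`su2_wilson_exp_moment_upTo_oneTwelfth`): `SU(2)` on `ℤ⁴`, `0 ≤ β_W ≤ 1/12`, every DLR state, all bounded measurable local
  `F₁, F₂`: `Σ_v 2^{a‖v‖}… ` precisely `Σ_v e^{a‖v‖_∞}|cov_μ(F₁,F₂∘θ_v)| < ∞` for every `a < log 2` (rb-p1's explicit clustering rate `log 2` +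
  ds-3's bridge `perturbed_covariance_decay_of_memBallZd`); STAR WINDOW (`su2_wilson_exp_moments_star`): `|β_W| ≤ 9/25`, every DLR state,
  gauge-invariant local observables, some `m > 0`.
WHAT THIS IS NOT: no lower bound on correlations, no value of `ξ₂`, no relation `ξ₂ ≤ 1/m` beyond finiteness of the defining sums; lattice;
nothing about the continuum or the Clay problem.

References: B. Simon, *The Statistical Mechanics of Lattice Gases* I (1993), §II.12; I. Montvay, G. Münster, *Quantum Fields on a Lattice*
(1994), §2.4 (second-moment correlation length); the tree's `LatticeSumL1.lean`.
-/

noncomputable section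

open MeasureTheory Filter Function ProbabilityTheory Real
open scoped NNReal
open Literature.Probability.LatticeModels hiding configShift configShift_apply
open Literature.MathematicalPhysics.QuantumLattice
open Literature.MathematicalPhysics.QuantumFieldTheory hiding ZdEdge Site IsLocalObservable
open Literature.Barriers.QuantumFields (IsMassiveState)
open Summit.Ventures.YMGap.PlaquetteSusceptibility (l1_le_mul_norm)

namespace Summit.Ventures.YMGap.RobustBall

namespace CorrelationMoments

variable {d : ℕ}

/-! ### Generic: exponential moments below the decay rate -/

/-- **Exponentially weighted sums below the decay rate**: if `|G v| ≤ C e^{−m‖v‖_∞}` on `ℤ^d` (`d ≥ 1`) and `a < m`, then for every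
finite set `F` of sites `Σ_{v∈F} e^{a‖v‖_∞}|G v| ≤ max(C,0)·((1+r)/(1−r))^d` with `r = e^{−(m−a)/d}` (`‖v‖_∞ ≥ ‖v‖₁/d` and rb-p1's
`ℓ¹` lattice sum). [folklore] -/
theorem sum_exp_mul_abs_le_of_decay (hd : 1 ≤ d) {G : Site d → ℝ} {m C a : ℝ} (ham : a < m)
    (hG : ∀ v, |G v| ≤ C * exp (-m * ‖v‖)) (F : Finset (Site d)) :
    ∑ v ∈ F, exp (a * ‖v‖) * |G v| ≤
      max C 0 * ((1 + exp (-((m - a) / d))) / (1 - exp (-((m - a) / d)))) ^ d := by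
  have hd0 : (0 : ℝ) < d := by exact_mod_cast hd
  set r : ℝ := exp (-((m - a) / d)) with hr
  have hr0 : 0 ≤ r := (exp_pos _).le
  have hr1 : r < 1 := Real.exp_lt_one_iff.2 (neg_neg_of_pos (div_pos (by linarith) hd0))
  have hpt : ∀ v ∈ F, exp (a * ‖v‖) * |G v| ≤ max C 0 * r ^ l1 v := by
    intro v _
    have h1 : exp (a * ‖v‖) * exp (-m * ‖v‖) = exp (-(m - a) * ‖v‖) := by rw [← Real.exp_add]; ring_nf
    have h2 : exp (-(m - a) * ‖v‖) ≤ r ^ l1 v := by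
      rw [hr, ← Real.exp_nat_mul]
      refine exp_le_exp.2 ?_
      have hl : (l1 v : ℝ) ≤ d * ‖v‖ := l1_le_mul_norm v
      have : (l1 v : ℝ) * ((m - a) / d) ≤ (m - a) * ‖v‖ := by
        rw [mul_div_assoc', div_le_iff₀ hd0]; nlinarith
      linarith
    calc exp (a * ‖v‖) * |G v| ≤ exp (a * ‖v‖) * (C * exp (-m * ‖v‖)) :=
          mul_le_mul_of_nonneg_left (hG v) (exp_pos _).le
      _ ≤ exp (a * ‖v‖) * (max C 0 * exp (-m * ‖v‖)) :=
          mul_le_mul_of_nonneg_left (mul_le_mul_of_nonneg_right (le_max_left _ _) (exp_pos _).le) (exp_pos _).le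
      _ = max C 0 * (exp (a * ‖v‖) * exp (-m * ‖v‖)) := by ring
      _ ≤ max C 0 * r ^ l1 v := by rw [h1]; exact mul_le_mul_of_nonneg_left h2 (le_max_right _ _)
  calc ∑ v ∈ F, exp (a * ‖v‖) * |G v| ≤ ∑ v ∈ F, max C 0 * r ^ l1 v := Finset.sum_le_sum hpt
    _ = max C 0 * ∑ v ∈ F, r ^ l1 v := by rw [Finset.mul_sum]
    _ ≤ max C 0 * ((1 + r) / (1 - r)) ^ d := mul_le_mul_of_nonneg_left (sum_pow_l1_le hr0 hr1 F) (le_max_right _ _)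

/-- **The exponentially weighted susceptibility is finite below the decay rate**: under the same hypotheses
`v ↦ e^{a‖v‖_∞}|G v|` is summable over `ℤ^d` with sum `≤ max(C,0)((1+r)/(1−r))^d`. [folklore] -/
theorem summable_exp_mul_abs_of_decay (hd : 1 ≤ d) {G : Site d → ℝ} {m C a : ℝ} (ham : a < m)
    (hG : ∀ v, |G v| ≤ C * exp (-m * ‖v‖)) :
    Summable (fun v : Site d => exp (a * ‖v‖) * |G v|) ∧
      ∑' v : Site d, exp (a * ‖v‖) * |G v| ≤
        max C 0 * ((1 + exp (-((m - a) / d))) / (1 - exp (-((m - a) / d)))) ^ d :=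
  ⟨summable_of_sum_le (fun v => by positivity) (sum_exp_mul_abs_le_of_decay hd ham hG),
    Real.tsum_le_of_sum_le (fun v => by positivity) (sum_exp_mul_abs_le_of_decay hd ham hG)⟩

/-- **Every polynomial moment of an exponentially decaying correlation is finite**: if `|G v| ≤ C e^{−m‖v‖_∞}` (`m > 0`, `d ≥ 1`) then
`v ↦ ‖v‖_∞^k |G v|` is summable over `ℤ^d` for every `k` — in particular the numerator `Σ_v ‖v‖² |cov_μ(F, F∘θ_v)|` of the second-moment
correlation length. [folklore] -/
theorem summable_pow_mul_abs_of_decay (hd : 1 ≤ d) {G : Site d → ℝ} {m C : ℝ} (hm : 0 < m)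
    (hG : ∀ v, |G v| ≤ C * exp (-m * ‖v‖)) (k : ℕ) :
    Summable fun v : Site d => ‖v‖ ^ k * |G v| := by
  have ha : (0 : ℝ) < m / 2 := by positivity
  have hexp := (summable_exp_mul_abs_of_decay hd (show m / 2 < m by linarith) hG).1
  -- `x^k ≤ k!·a^{−k}·e^{a x}` for `a = m/2`, `x = ‖v‖ ≥ 0` (one term of the exponential series)
  have hpow : ∀ v : Site d, ‖v‖ ^ k ≤ (k.factorial : ℝ) / (m / 2) ^ k * exp (m / 2 * ‖v‖) := by
    intro v
    have h := Real.pow_div_factorial_le_exp (m / 2 * ‖v‖) (mul_nonneg ha.le (norm_nonneg _)) k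
    rw [mul_pow, div_le_iff₀ (by positivity)] at h
    rw [div_mul_eq_mul_div, le_div_iff₀ (pow_pos ha k)]
    linarith
  refine Summable.of_nonneg_of_le (fun v => by positivity) (fun v => ?_) (hexp.mul_left ((k.factorial : ℝ) / (m / 2) ^ k))
  calc ‖v‖ ^ k * |G v| ≤ ((k.factorial : ℝ) / (m / 2) ^ k * exp (m / 2 * ‖v‖)) * |G v| :=
        mul_le_mul_of_nonneg_right (hpow v) (abs_nonneg _)
    _ = (k.factorial : ℝ) / (m / 2) ^ k * (exp (m / 2 * ‖v‖) * |G v|) := by ring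

/-- **Exponentially small tails**: if `|G v| ≤ C e^{−m‖v‖_∞}` and `0 ≤ a < m`, then for every `k` the tail of `Σ|G|` outside the
centred box `B_k = siteBox d k` satisfies `Σ_{v ∉ B_k} |G v| ≤ e^{−a(k+1)} · max(C,0)((1+r)/(1−r))^d`, `r = e^{−(m−a)/d}` (on the complement
`‖v‖_∞ ≥ k+1`, so `|G v| ≤ e^{−a(k+1)} e^{a‖v‖}|G v|`) — the susceptibility series of a massive state converges exponentially fast in the
box cutoff. [folklore] -/
theorem tsum_abs_compl_siteBox_le_of_decay (hd : 1 ≤ d) {G : Site d → ℝ} {m C a : ℝ} (ha0 : 0 ≤ a) (ham : a < m)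
    (hG : ∀ v, |G v| ≤ C * exp (-m * ‖v‖)) (k : ℕ) :
    Summable (fun v : {v : Site d // v ∉ siteBox d k} => |G v|) ∧
      ∑' v : {v : Site d // v ∉ siteBox d k}, |G v| ≤
        exp (-(a * (k + 1))) * (max C 0 * ((1 + exp (-((m - a) / d))) / (1 - exp (-((m - a) / d)))) ^ d) := by
  obtain ⟨hsum, hle⟩ := summable_exp_mul_abs_of_decay hd ham hG
  set M : ℝ := max C 0 * ((1 + exp (-((m - a) / d))) / (1 - exp (-((m - a) / d)))) ^ d with hM
  have habs : Summable fun v : Site d => |G v| := by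
    refine Summable.of_nonneg_of_le (fun v => abs_nonneg _) (fun v => ?_) hsum
    have h1 : (1 : ℝ) ≤ exp (a * ‖v‖) := Real.one_le_exp (mul_nonneg ha0 (norm_nonneg _))
    calc |G v| = 1 * |G v| := (one_mul _).symm
      _ ≤ exp (a * ‖v‖) * |G v| := mul_le_mul_of_nonneg_right h1 (abs_nonneg _)
  refine ⟨habs.subtype _, ?_⟩
  -- on the complement of the box `‖v‖ ≥ k+1`, hence `|G v| ≤ e^{−a(k+1)} e^{a‖v‖} |G v|`
  have hpt : ∀ v : {v : Site d // v ∉ siteBox d k}, |G v| ≤ exp (-(a * (k + 1))) * (exp (a * ‖(v : Site d)‖) * |G v|) := by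
    intro v
    have hv : ((k : ℝ) + 1) ≤ ‖(v : Site d)‖ := by
      have h := v.2
      rw [mem_siteBox_iff_norm, not_le] at h
      -- `‖v‖` is an integer-valued sup norm: `‖v‖ > k ⇒ ‖v‖ ≥ k + 1`
      obtain ⟨i, hi⟩ : ∃ i, ‖(v : Site d)‖ = ‖(v : Site d) i‖ := by
        have hne : (Finset.univ : Finset (Fin d)).Nonempty := Finset.univ_nonempty_iff.2 ⟨⟨0, hd⟩⟩
        obtain ⟨i, -, hi⟩ := Finset.exists_mem_eq_sup' hne fun i => ‖(v : Site d) i‖₊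
        refine ⟨i, ?_⟩
        rw [Pi.norm_def, ← Finset.sup'_eq_sup hne]
        exact congrArg NNReal.toReal hi
      rw [hi, Int.norm_eq_abs] at h ⊢
      have : (k : ℤ) < |(v : Site d) i| := by exact_mod_cast h
      exact_mod_cast (Int.add_one_le_iff.2 this)
    have h1 : (1 : ℝ) ≤ exp (-(a * (k + 1))) * exp (a * ‖(v : Site d)‖) := by
      rw [← Real.exp_add]; exact Real.one_le_exp (by nlinarith)
    calc |G v| = 1 * |G v| := (one_mul _).symm
      _ ≤ (exp (-(a * (k + 1))) * exp (a * ‖(v : Site d)‖)) * |G v| := mul_le_mul_of_nonneg_right h1 (abs_nonneg _)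
      _ = exp (-(a * (k + 1))) * (exp (a * ‖(v : Site d)‖) * |G v|) := by ring
  calc ∑' v : {v : Site d // v ∉ siteBox d k}, |G v|
      ≤ ∑' v : {v : Site d // v ∉ siteBox d k}, exp (-(a * (k + 1))) * (exp (a * ‖(v : Site d)‖) * |G v|) :=
        (habs.subtype _).tsum_le_tsum hpt ((hsum.subtype _).mul_left _)
    _ = exp (-(a * (k + 1))) * ∑' v : {v : Site d // v ∉ siteBox d k}, exp (a * ‖(v : Site d)‖) * |G v| := tsum_mul_left
    _ ≤ exp (-(a * (k + 1))) * M := by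
        refine mul_le_mul_of_nonneg_left ?_ (exp_pos _).le
        exact (Summable.tsum_subtype_le (fun v => exp (a * ‖v‖) * |G v|) {v | v ∉ siteBox d k} (fun v => by positivity) hsum).trans hle

/-! ### An explicit rate for the thermodynamic variance density (with `ThermodynamicVariance.lean`) -/

/-- ★★ **EXPLICIT RATE IN C-TVAR**: for a translation-invariant probability measure `μ` on the `ℤ^d` link configurations (`d ≥ 1`) and a
bounded measurable `f` whose autocovariance decays at the `ℓ^∞` rate `m` (`|cov_μ(f, f∘θ_v)| ≤ C e^{−m‖v‖}`), for every `0 ≤ a < m` and all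
`k ≤ n`: `|Var_μ(Σ_{x∈B_n} f∘θ_x)/#B_n − Σ_v cov_μ(f, f∘θ_v)| ≤ e^{−a(k+1)}·M_a + (2dk/(2n+1))·M_0`, `M_b = max(C,0)((1+r_b)/(1−r_b))^d`,
`r_b = e^{−(m−b)/d}` (this file's exponential tails in `ThermodynamicVariance.abs_variance_boxSum_div_sub_le`; with `k ≍ (log n)/a` the rate
is `O((log n)/n)`). [folklore] -/
theorem abs_variance_boxSum_div_sub_le_of_decay (hd : 1 ≤ d) {H : Type*} [MeasurableSpace H] {μ : Measure (LGConfig d H)}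
    [IsProbabilityMeasure μ] (hμ : IsZdTranslationInvariant μ) {f : LGConfig d H → ℝ} (hfm : Measurable f) {M : ℝ}
    (hfb : ∀ U, |f U| ≤ M) {m C a : ℝ} (ha0 : 0 ≤ a) (ham : a < m)
    (hdec : ∀ v : Site d, |cov[f, fun U => f (configShift v U); μ]| ≤ C * exp (-m * ‖v‖)) {n k : ℕ} (hk : k ≤ n) :
    |Var[fun U => ∑ x ∈ siteBox d n, f (configShift x U); μ] / (siteBox d n).card -
        ∑' v, cov[f, fun U => f (configShift v U); μ]| ≤
      exp (-(a * (k + 1))) * (max C 0 * ((1 + exp (-((m - a) / d))) / (1 - exp (-((m - a) / d)))) ^ d) +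
        2 * (d : ℝ) * k / (2 * n + 1) * (max C 0 * ((1 + exp (-((m - 0) / d))) / (1 - exp (-((m - 0) / d)))) ^ d) := by
  have hm : 0 < m := lt_of_le_of_lt ha0 ham
  obtain ⟨hs0, hA⟩ := summable_exp_mul_abs_of_decay hd hm hdec (a := 0)
  have hsum : Summable fun v : Site d => |cov[f, fun U => f (configShift v U); μ]| := by
    refine hs0.congr fun v => ?_
    rw [zero_mul, Real.exp_zero, one_mul]
  have hA' : ∑' v, |cov[f, fun U => f (configShift v U); μ]| ≤
      max C 0 * ((1 + exp (-((m - 0) / d))) / (1 - exp (-((m - 0) / d)))) ^ d := by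
    refine le_trans (le_of_eq (tsum_congr fun v => ?_)) hA
    rw [zero_mul, Real.exp_zero, one_mul]
  have htail := (tsum_abs_compl_siteBox_le_of_decay hd ha0 ham hdec k).2
  have key := ThermodynamicVariance.abs_variance_boxSum_div_sub_le hμ hfm hfb hsum hk
  refine key.trans (add_le_add htail ?_)
  exact mul_le_mul_of_nonneg_left hA' (by positivity)

/-! ### Massive states and the cells -/

/-- **EVERY MASSIVE STATE HAS ALL EXPONENTIAL MOMENTS BELOW ITS RATE AND ALL POLYNOMIAL MOMENTS** of the truncated correlations of
bounded measurable gauge-invariant local observables (`d = 4`). [folklore] -/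
theorem exp_moments_of_isMassiveState {G : Type*} [Group G] [MeasurableSpace G] {μ : Measure (LGConfig 4 G)}
    (hμ : IsMassiveState μ) :
    ∃ m : ℝ, 0 < m ∧ ∀ (F₁ F₂ : LGConfig 4 G → ℝ),
      Literature.MathematicalPhysics.QuantumLattice.IsLocalObservable F₁ →
      Literature.MathematicalPhysics.QuantumLattice.IsLocalObservable F₂ →
      Measurable F₁ → Measurable F₂ → (∃ C, ∀ U, |F₁ U| ≤ C) → (∃ C, ∀ U, |F₂ U| ≤ C) →
      IsZdGaugeInvariant F₁ → IsZdGaugeInvariant F₂ →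
        (∀ a : ℝ, 0 ≤ a → a < m →
          Summable fun v : Site 4 => exp (a * ‖v‖) * |cov[F₁, fun U => F₂ (configShift v U); μ]|) ∧
        ∀ k : ℕ, Summable fun v : Site 4 => ‖v‖ ^ k * |cov[F₁, fun U => F₂ (configShift v U); μ]| := by
  obtain ⟨m, hm⟩ := hμ
  have hm0 : 0 < m := by
    have h := hm (fun _ => 0) (fun _ => 0) ⟨∅, fun _ _ _ => rfl⟩ ⟨∅, fun _ _ _ => rfl⟩ measurable_const measurable_const
      ⟨0, fun _ => by simp⟩ ⟨0, fun _ => by simp⟩ (fun _ _ => rfl) (fun _ _ => rfl)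
    exact h.1
  refine ⟨m, hm0, fun F₁ F₂ hl₁ hl₂ hm₁ hm₂ hb₁ hb₂ hg₁ hg₂ => ?_⟩
  obtain ⟨-, C, hC⟩ := hm F₁ F₂ hl₁ hl₂ hm₁ hm₂ hb₁ hb₂ hg₁ hg₂
  exact ⟨fun a _ ham => (summable_exp_mul_abs_of_decay (d := 4) (by norm_num) ham hC).1,
    fun k => summable_pow_mul_abs_of_decay (d := 4) (by norm_num) hm0 hC k⟩

/-- ★ **THE WILSON POINT, EXPLICIT**: for `0 ≤ β_W ≤ 1/12`, EVERY DLR state `μ` of `SU(2)` lattice Yang–Mills on `ℤ⁴` (tree coupling `β_W/2`)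
and all bounded measurable local `F₁, F₂`: for every `0 ≤ a < log 2` the exponentially weighted susceptibility
`Σ_v e^{a‖v‖_∞}|cov_μ(F₁, F₂∘θ_v)|` is finite, and every polynomial moment `Σ_v ‖v‖_∞^k |cov_μ(F₁, F₂∘θ_v)|` is finite (rb-p1's explicit
clustering rate `log 2`, `su2_wilson_clustering_upTo_oneTwelfth`, + ds-3's bridge `perturbed_covariance_decay_of_memBallZd`). [folklore] -/
theorem su2_wilson_exp_moment_upTo_oneTwelfth {βW : ℝ} (h0 : 0 ≤ βW) (h : βW ≤ 1 / 12)
    {μ : Measure (LGConfig 4 (Matrix.specialUnitaryGroup (Fin 2) ℂ))}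
    (hμ : μ ∈ ymGibbsMeasures (d := 4) (fundamentalRep (Fin 2)) (βW / 2))
    (F₁ F₂ : LGConfig 4 (Matrix.specialUnitaryGroup (Fin 2) ℂ) → ℝ)
    (h₁ : Literature.MathematicalPhysics.QuantumLattice.IsLocalObservable F₁)
    (h₂ : Literature.MathematicalPhysics.QuantumLattice.IsLocalObservable F₂) (h₁m : Measurable F₁) (h₂m : Measurable F₂)
    (hb₁ : ∃ C, ∀ U, |F₁ U| ≤ C) (hb₂ : ∃ C, ∀ U, |F₂ U| ≤ C) :
    (∀ a : ℝ, 0 ≤ a → a < Real.log 2 →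
      Summable fun v : Site 4 => exp (a * ‖v‖) * |cov[F₁, fun U => F₂ (configShift v U); μ]|) ∧
    ∀ k : ℕ, Summable fun v : Site 4 => ‖v‖ ^ k * |cov[F₁, fun U => F₂ (configShift v U); μ]| := by
  have hβ : (((2 : ℕ) : ℝ) * (βW / 4) : ℝ) = βW / 2 := by push_cast; ring
  have hmem : MemBallZd (N := 2) (0 : ℝ) 0 0 (0 : Potential (ZdEdge 4) (Matrix.specialUnitaryGroup (Fin 2) ℂ))
      (fun _ => (∅ : Finset (Finset (ZdEdge 4)))) :=
    memBallZd_zero le_rfl le_rfl fun _ _ h => by simp at h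
  have hμ' : μ ∈ perturbedGibbsMeasures (d := 4) (fundamentalRep (Fin 2)) ((2 : ℕ) * (βW / 4)) 0
      (fun _ => (∅ : Finset (Finset (ZdEdge 4)))) := by
    rwa [perturbedGibbsMeasures_zero, hβ]
  have hcl := su2_wilson_clustering_upTo_oneTwelfth h0 h μ hμ'
  obtain ⟨C, hC⟩ := perturbed_covariance_decay_of_memBallZd (d := 4) (by norm_num) (by norm_num)
    (((2 : ℕ) : ℝ) * (βW / 4)) hmem hμ' (Real.log_pos (by norm_num))
    (fun n => ⟨32 * (n : ℝ) ^ 2, fun G₁ G₂ Λ₁ Λ₂ K₁ K₂ hn₁ hn₂ hdis hG₁ hG₂ =>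
      hcl n G₁ G₂ Λ₁ Λ₂ K₁ K₂ hn₁ hn₂ hdis hG₁ hG₂⟩) F₁ F₂ h₁ h₂ h₁m h₂m hb₁ hb₂
  exact ⟨fun a _ ham => (summable_exp_mul_abs_of_decay (d := 4) (by norm_num) ham hC).1,
    fun k => summable_pow_mul_abs_of_decay (d := 4) (by norm_num) (Real.log_pos (by norm_num)) hC k⟩

/-- **THE STAR WINDOW**: for `|b| ≤ 9/50` (tree coupling; `|β_W| ≤ 9/25`), EVERY DLR state of `SU(2)` on `ℤ⁴` is massive
(`isMassiveState_of_massGapAt` + `ImprovedThresholdStar.su2_massGapAt_of_abs_le`), hence there is `m > 0` such that all exponential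
moments below `m` and all polynomial moments of the truncated correlations of bounded measurable gauge-invariant local observables are
finite. [folklore] -/
theorem su2_wilson_exp_moments_star {b : ℝ} (hb : |b| ≤ 9 / 50)
    {μ : Measure (LGConfig 4 (Matrix.specialUnitaryGroup (Fin 2) ℂ))}
    (hμ : μ ∈ ymGibbsMeasures (d := 4) (fundamentalRep (Fin 2)) b) :
    ∃ m : ℝ, 0 < m ∧ ∀ (F₁ F₂ : LGConfig 4 (Matrix.specialUnitaryGroup (Fin 2) ℂ) → ℝ),
      Literature.MathematicalPhysics.QuantumLattice.IsLocalObservable F₁ →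
      Literature.MathematicalPhysics.QuantumLattice.IsLocalObservable F₂ →
      Measurable F₁ → Measurable F₂ → (∃ C, ∀ U, |F₁ U| ≤ C) → (∃ C, ∀ U, |F₂ U| ≤ C) →
      IsZdGaugeInvariant F₁ → IsZdGaugeInvariant F₂ →
        (∀ a : ℝ, 0 ≤ a → a < m →
          Summable fun v : Site 4 => exp (a * ‖v‖) * |cov[F₁, fun U => F₂ (configShift v U); μ]|) ∧
        ∀ k : ℕ, Summable fun v : Site 4 => ‖v‖ ^ k * |cov[F₁, fun U => F₂ (configShift v U); μ]| := by
  have hb' : |b / 2| ≤ 9 / 100 := by rw [abs_div, abs_two]; linarith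
  have hμ2 : μ ∈ ymGibbsMeasures (d := 4) (fundamentalRep (Fin 2)) (((2 : ℕ) : ℝ) * (b / 2)) := by
    have e : (((2 : ℕ) : ℝ) * (b / 2)) = b := by push_cast; ring
    rw [e]; exact hμ
  exact exp_moments_of_isMassiveState
    (Summit.Ventures.YMGap.MassGapMassive.isMassiveState_of_massGapAt (N := 2) (by norm_num)
      (ImprovedThresholdStar.su2_massGapAt_of_abs_le hb') μ hμ2)

end CorrelationMoments

end Summit.Ventures.YMGap.RobustBall

end
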